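import Literature.AnabelianGeometry.SemiGraphs.TemperedVerticial
import Literature.AnabelianGeometry.SemiGraphs.SubdivisionLemmas
import HarnessLib

/-!
# The ray semi-graph and the semi-graph of anabelioids `𝒢_θ` on it (FRONTIER programme «REFUTE-F1732»,
# brick R3: the OBJECT)

Mochizuki, *Semi-graphs of anabelioids*, Publ. RIMS **42** (2006) 221–322, §1 p. 11 (semi-graphs),
Def 2.1 p. 22 (semi-graphs of anabelioids in the local presentation "semi-graph of profinite groups",
p. 23), Thm 3.7 (iii) p. 41 [cite: MochizukiSemiAnbd2006, Def 2.1 p.22].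

abc-iut cell, layer L3, FRONTIER programme `plan/L3/SUBDAG-SemiAnbd-Thm37iii-REFUTE.md` (writer
abc-iut-L3-lead; erratum-grade, LOW priority), brick **R3** (seat abc-iut-w6-d070).  HONEST FRAMING (α59):
towards a kernel erratum for the ∀-countable reading of [SemiAnbd] Thm 3.7 (iii) ([IUTchI] Rmk 2.5.3); desk
countermodel by abc-iut-L3-d1 g3, memo `HOME/staging/L3/L3-d1/g3/COUNTERMODEL-Thm37iii-infinite.md`
(sha16 8b26b5199c29f55f), §1 "The object 𝒢_θ"; print proves the FINITE-`𝔾` case (kernel: p431007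
`compactInVerticialAt_of_finiteGraph`), which is the only case IUT consumes.  Nothing here asserts or refutes
anything of [SemiAnbd]; it DEFINES an object.  No side taken on [IUTchIII] Cor 3.12.

CONTENT (definitions + their elementary properties; BINDER form — the vertex group `G`, the edge group `E`
and the gluing homomorphisms are parameters, so that brick R1's free pro-`p` group of rank 2
(`FreeProPRankTwo`, abc-iut-w6-d019), `E = ℤ_p`, `α : 1 ↦ a` and `θ_{n_k} ∘ α : 1 ↦ a·b^{p^{n_k}}` enter only
at instantiation):

* `SemiGraph.ray` — the ray `𝔾 = ℕ`: vertices `v_k`, CLOSED edges `e_k = [v_k, v_{k+1}]`, branches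
  `β_k⁻ := (k, false) ↦ v_k` and `β_k⁺ := (k, true) ↦ v_{k+1}` (memo §1); a countable, connected, locally
  finite, untangled graph with a vertex; its stars (`abuts b = some 0 ↔ b = β_0⁻`,
  `abuts b = some (k+1) ↔ b = β_k⁺ ∨ b = β_{k+1}⁻`).
* `ProfiniteSemiGraph.thetaRay G E up low` — ALL vertex groups `G`, ALL edge groups `E`, `brHom β_k⁺ := up`
  (memo: `α`, `1 ↦ a`, into `G_{v_{k+1}}`) and `brHom β_k⁻ := low k` (memo: `θ_k ∘ α`, `1 ↦ a·b^{p^{n_k}}`,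
  into `G_{v_k}`); (H1) of `Prop36Hypotheses`: connected, countable, has a vertex, of injective type (given
  injective gluings), a graph; verticially slim given `G` slim; branch subgroups `= range up` /
  `= range (low k)`.
* `ProfiniteSemiGraph.thetaRayOfTwists G E α θ n := thetaRay G E α (fun k => (θ (n k)).comp α)` — the memo's
  shape with twists `θ_m : G →ₜ* G` and an exponent sequence `n : ℕ → ℕ`; branch subgroups
  `A := range α` at every `β_k⁺` and `A_{n_k} := A.map θ_{n_k}` at `β_k⁻`.

No instance beyond those packaged in `ProfiniteSemiGraph`; no named fact; nothing of the paper retyped.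
-/

namespace Literature.AnabelianGeometry.SemiGraphs

namespace SemiGraph

/-! ### The ray -/

/-- **The ray** `𝔾 = ℕ` ([SemiAnbd] §1 p. 11; the underlying semi-graph of abc-iut-L3-d1's `𝒢_θ`, memo §1):
vertices `v_k` (`k : ℕ`), edges `e_k` (`k : ℕ`), each with the two branches `β_k⁻ = (k, false)`, abutting
to `v_k`, and `β_k⁺ = (k, true)`, abutting to `v_{k+1}`. [cite: MochizukiSemiAnbd2006, §1 p.11] -/
abbrev ray : SemiGraph.{0} where
  Vertex := ℕ
  Edge := ℕ
  Branch := ℕ × Bool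
  edgeOf b := b.1
  abuts b := some (if b.2 then b.1 + 1 else b.1)
  two_branches e := ⟨(e, false), (e, true), fun h => Bool.false_ne_true (congrArg Prod.snd h), rfl, rfl,
    fun b hb => by
    obtain ⟨e', c⟩ := b
    change e' = e at hb
    subst hb
    cases c
    · exact Or.inl rfl
    · exact Or.inr rfl⟩

/-- The edge of a branch of the ray. [cite: MochizukiSemiAnbd2006, §1 p.11] -/
@[simp] theorem ray_edgeOf (b : ℕ × Bool) : ray.edgeOf b = b.1 := rfl

/-- The branch `β_k⁻ = (k, false)` abuts to `v_k`. [cite: MochizukiSemiAnbd2006, §1 p.11] -/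
@[simp] theorem ray_abuts_false (k : ℕ) : ray.abuts (k, false) = some k := rfl

/-- The branch `β_k⁺ = (k, true)` abuts to `v_{k+1}`. [cite: MochizukiSemiAnbd2006, §1 p.11] -/
@[simp] theorem ray_abuts_true (k : ℕ) : ray.abuts (k, true) = some (k + 1) := rfl

/-- The coincidence map of the ray in closed form. [cite: MochizukiSemiAnbd2006, §1 p.11] -/
theorem ray_abuts (b : ℕ × Bool) : ray.abuts b = some (if b.2 then b.1 + 1 else b.1) := rfl

/-- The ray is a graph: every branch abuts to a vertex. [cite: MochizukiSemiAnbd2006, §1 p.11] -/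
theorem ray_isGraph : ray.IsGraph := ⟨fun _ => rfl⟩

/-- The ray is countable. [cite: MochizukiSemiAnbd2006, §1 p.11] -/
theorem ray_isCountable : ray.IsCountable :=
  ⟨(inferInstance : Countable ℕ), (inferInstance : Countable ℕ)⟩

/-- The ray has a vertex. [cite: MochizukiSemiAnbd2006, §1 p.11] -/
theorem ray_nonempty_vertex : Nonempty ray.Vertex := ⟨(0 : ℕ)⟩

/-- The edge `e_k` abuts to `v_k` (through `β_k⁻`). [cite: MochizukiSemiAnbd2006, §1 p.11] -/
theorem ray_edgeAbuts_self (k : ℕ) : ray.EdgeAbuts k k := ⟨(k, false), rfl, rfl⟩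

/-- The edge `e_k` abuts to `v_{k+1}` (through `β_k⁺`). [cite: MochizukiSemiAnbd2006, §1 p.11] -/
theorem ray_edgeAbuts_succ (k : ℕ) : ray.EdgeAbuts k (k + 1) := ⟨(k, true), rfl, rfl⟩

/-- The edge `e` abuts to `v` iff `v = e` or `v = e + 1`. [cite: MochizukiSemiAnbd2006, §1 p.11] -/
theorem ray_edgeAbuts_iff {e v : ℕ} : ray.EdgeAbuts e v ↔ v = e ∨ v = e + 1 := by
  constructor
  · rintro ⟨⟨e', c⟩, he, hb⟩
    change e' = e at he
    subst he
    cases c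
    · left
      simpa using hb.symm
    · right
      simpa using hb.symm
  · rintro (h | h) <;> rw [h]
    · exact ray_edgeAbuts_self e
    · exact ray_edgeAbuts_succ e

/-- The edge `e_k` joins `v_k` to `v_{k+1}`. [cite: MochizukiSemiAnbd2006, §1 p.11] -/
theorem ray_joins (k : ℕ) : ray.Joins k k (k + 1) :=
  ⟨(k, false), (k, true), fun h => Bool.false_ne_true (congrArg Prod.snd h), rfl, rfl, rfl, rfl⟩

/-- The star of `v_0` is the single branch `β_0⁻`. [cite: MochizukiSemiAnbd2006, §1 p.13] -/
theorem ray_abuts_eq_some_zero_iff {b : ℕ × Bool} : ray.abuts b = some 0 ↔ b = (0, false) := by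
  obtain ⟨k, c⟩ := b
  cases c
  · simp
  · simp

/-- The star of `v_{k+1}` consists of `β_k⁺` and `β_{k+1}⁻`. [cite: MochizukiSemiAnbd2006, §1 p.13] -/
theorem ray_abuts_eq_some_succ_iff {b : ℕ × Bool} {k : ℕ} :
    ray.abuts b = some (k + 1) ↔ b = (k, true) ∨ b = (k + 1, false) := by
  obtain ⟨m, c⟩ := b
  cases c
  · simp
  · show some (m + 1) = some (k + 1) ↔ _
    simp only [Option.some.injEq, Prod.mk.injEq, and_true, Bool.true_eq_false, and_false, or_false]
    omega

/-- The ray is untangled: `e_k` joins the DISTINCT vertices `v_k`, `v_{k+1}`.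
[cite: MochizukiSemiAnbd2006, §1 p.13] -/
theorem ray_isUntangled : ray.IsUntangled :=
  ⟨fun e _ => ⟨e, e + 1, ne_of_lt (Nat.lt_succ_self e), ray_joins e⟩⟩

/-- The ray is locally finite: the edges at `v` are among `e_{v-1}`, `e_v`. [cite: MochizukiSemiAnbd2006, §1 p.13] -/
theorem ray_isLocallyFinite : ray.IsLocallyFinite := by
  refine ⟨fun v => (Set.finite_le_nat v).subset ?_⟩
  intro e he
  rcases (ray_edgeAbuts_iff.mp he) with h | h
  · exact le_of_eq h.symm
  · change e ≤ v; omega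

/-- Every vertex-point of the subdivision of the ray is reachable from `v_0` (along
`v_k — β_k⁻ — e_k — β_k⁺ — v_{k+1}`). [cite: MochizukiSemiAnbd2006, §1 pp.11-13] -/
theorem ray_reachable_vertex (k : ℕ) : ray.subdivision.Reachable (Sum.inl (0 : ℕ)) (Sum.inl k) := by
  induction k with
  | zero => exact SimpleGraph.Reachable.refl _
  | succ k ih =>
    refine ih.trans ?_
    -- `v_k — β_k⁻ — e_k — β_k⁺ — v_{k+1}`
    have h1 : ray.subdivision.Adj (Sum.inr (Sum.inr ((k, false) : ℕ × Bool))) (Sum.inl k) :=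
      ray.subdivision_adj_of_nodeRel (NodeRel.branch_vertex (G := ray) (k, false) k rfl)
    have h2 : ray.subdivision.Adj (Sum.inr (Sum.inl k)) (Sum.inr (Sum.inr ((k, false) : ℕ × Bool))) :=
      ray.subdivision_adj_of_nodeRel (NodeRel.edge_branch (G := ray) (k, false))
    have h3 : ray.subdivision.Adj (Sum.inr (Sum.inl k)) (Sum.inr (Sum.inr ((k, true) : ℕ × Bool))) :=
      ray.subdivision_adj_of_nodeRel (NodeRel.edge_branch (G := ray) (k, true))
    have h4 : ray.subdivision.Adj (Sum.inr (Sum.inr ((k, true) : ℕ × Bool))) (Sum.inl (k + 1)) :=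
      ray.subdivision_adj_of_nodeRel (NodeRel.branch_vertex (G := ray) (k, true) (k + 1) rfl)
    exact ((h1.symm.reachable.trans h2.symm.reachable).trans h3.reachable).trans h4.reachable

/-- Every point of the subdivision of the ray is reachable from `v_0`.
[cite: MochizukiSemiAnbd2006, §1 pp.11-13] -/
theorem ray_reachable (x : ray.Node) : ray.subdivision.Reachable (Sum.inl (0 : ℕ)) x := by
  have hed : ∀ e : ℕ, ray.subdivision.Reachable (Sum.inl (0 : ℕ)) (Sum.inr (Sum.inl e)) := fun e =>
    (ray_reachable_vertex e).trans
      (((ray.subdivision_adj_of_nodeRel (NodeRel.branch_vertex (G := ray) (e, false) e rfl)).symm.reachable).trans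
        (ray.subdivision_adj_of_nodeRel (NodeRel.edge_branch (G := ray) ((e, false) : ℕ × Bool))).symm.reachable)
  rcases x with k | e | b
  · exact ray_reachable_vertex k
  · exact hed e
  · exact (hed b.1).trans (ray.subdivision_adj_of_nodeRel (NodeRel.edge_branch (G := ray) b)).reachable

/-- **The ray is connected.** [cite: MochizukiSemiAnbd2006, §1 pp.11-13] -/
theorem ray_isConnected : ray.IsConnected := by
  haveI : Nonempty ray.Node := ⟨Sum.inl (0 : ℕ)⟩
  exact ⟨⟨fun x y => (ray_reachable x).symm.trans (ray_reachable y)⟩⟩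

end SemiGraph

/-! ### The semi-graph of anabelioids `𝒢_θ` on the ray -/

namespace ProfiniteSemiGraph

section ThetaRay

variable (G E : Type) [Group G] [TopologicalSpace G] [IsTopologicalGroup G] [CompactSpace G]
  [TotallyDisconnectedSpace G] [Group E] [TopologicalSpace E] [IsTopologicalGroup E] [CompactSpace E]
  [TotallyDisconnectedSpace E] (up : E →ₜ* G) (low : ℕ → (E →ₜ* G))

/-- **`𝒢_θ` in binder form** ([SemiAnbd] Def 2.1 p. 22, local presentation p. 23; abc-iut-L3-d1's
countermodel candidate, memo §1): on the ray, every vertex group is `G`, every edge group is `E`, the branch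
`β_k⁺` of `e_k` (abutting to `v_{k+1}`) is glued by `up : E → G` (memo: `α`, `1 ↦ a`) and the branch `β_k⁻`
(abutting to `v_k`) by `low k : E → G` (memo: `θ_k ∘ α`, `1 ↦ a·b^{p^{n_k}}`).  A DEFINITION; nothing is
asserted about [SemiAnbd] Thm 3.7. [cite: MochizukiSemiAnbd2006, Def 2.1 p.22] -/
def thetaRay : ProfiniteSemiGraph.{0} where
  graph := SemiGraph.ray
  Gv _ := G
  Ge _ := E
  brHom b _ _ := if b.2 then up else low b.1

/-- The underlying semi-graph of `𝒢_θ` is the ray. [cite: MochizukiSemiAnbd2006, Def 2.1 p.22] -/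
@[simp] theorem thetaRay_graph : (thetaRay G E up low).graph = SemiGraph.ray := rfl

/-- Every vertex group of `𝒢_θ` is `G`. [cite: MochizukiSemiAnbd2006, Def 2.1 p.22] -/
@[simp] theorem thetaRay_Gv (v : ℕ) : (thetaRay G E up low).Gv v = G := rfl

/-- Every edge group of `𝒢_θ` is `E`. [cite: MochizukiSemiAnbd2006, Def 2.1 p.22] -/
@[simp] theorem thetaRay_Ge (e : ℕ) : (thetaRay G E up low).Ge e = E := rfl

/-- The gluing along a branch, in closed form: `up` at `β_k⁺`, `low k` at `β_k⁻`.
[cite: MochizukiSemiAnbd2006, Def 2.1 p.22] -/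
theorem thetaRay_brHom (b : ℕ × Bool) (v : ℕ) (h : SemiGraph.ray.abuts b = some v) :
    (thetaRay G E up low).brHom b v h = (if b.2 then up else low b.1) := rfl

/-- The gluing along `β_k⁺` (into `G_{v_{k+1}}`) is `up`. [cite: MochizukiSemiAnbd2006, Def 2.1 p.22] -/
@[simp] theorem thetaRay_brHom_true (k v : ℕ) (h : SemiGraph.ray.abuts (k, true) = some v) :
    (thetaRay G E up low).brHom (k, true) v h = up := rfl

/-- The gluing along `β_k⁻` (into `G_{v_k}`) is `low k`. [cite: MochizukiSemiAnbd2006, Def 2.1 p.22] -/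
@[simp] theorem thetaRay_brHom_false (k v : ℕ) (h : SemiGraph.ray.abuts (k, false) = some v) :
    (thetaRay G E up low).brHom (k, false) v h = low k := rfl

/-- The branch subgroup `Π_{β_k⁺} ⊆ Π_{v_{k+1}}` is the image of `up` (memo: `A = ⟨a⟩‾`).
[cite: MochizukiSemiAnbd2006, §2 p.23] -/
theorem thetaRay_branchSubgroup_true (k v : ℕ) (h : SemiGraph.ray.abuts (k, true) = some v) :
    (thetaRay G E up low).branchSubgroup (k, true) v h = up.toMonoidHom.range := rfl

/-- The branch subgroup `Π_{β_k⁻} ⊆ Π_{v_k}` is the image of `low k` (memo: `A_{n_k} = ⟨a·b^{p^{n_k}}⟩‾`).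
[cite: MochizukiSemiAnbd2006, §2 p.23] -/
theorem thetaRay_branchSubgroup_false (k v : ℕ) (h : SemiGraph.ray.abuts (k, false) = some v) :
    (thetaRay G E up low).branchSubgroup (k, false) v h = (low k).toMonoidHom.range := rfl

/-! #### (H1) of `Prop36Hypotheses` for `𝒢_θ` -/

/-- `𝒢_θ` is connected. [cite: MochizukiSemiAnbd2006, Prop 3.6 p.38] -/
theorem thetaRay_isConnected : (thetaRay G E up low).IsConnected := SemiGraph.ray_isConnected

/-- `𝒢_θ` is countable. [cite: MochizukiSemiAnbd2006, Prop 3.6 p.38] -/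
theorem thetaRay_isCountable : (thetaRay G E up low).IsCountable := SemiGraph.ray_isCountable

/-- `𝒢_θ` has a vertex. [cite: MochizukiSemiAnbd2006, Prop 3.6 p.38] -/
theorem thetaRay_hasVertex : (thetaRay G E up low).HasVertex := SemiGraph.ray_nonempty_vertex

/-- `𝒢_θ` is a graph (of anabelioids): every branch abuts. [cite: MochizukiSemiAnbd2006, Def 2.1 p.22] -/
theorem thetaRay_isGraph : (thetaRay G E up low).IsGraph := SemiGraph.ray_isGraph

/-- `𝒢_θ` is of injective type as soon as all gluing homomorphisms are injective (memo §1: "`α`, `θ_kα`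
injective"). [cite: MochizukiSemiAnbd2006, Def 2.1 p.22] -/
theorem thetaRay_isOfInjectiveType (hup : Function.Injective up) (hlow : ∀ k, Function.Injective (low k)) :
    (thetaRay G E up low).IsOfInjectiveType := by
  rintro ⟨k, c⟩ v h
  cases c
  · exact hlow k
  · exact hup

/-- `𝒢_θ` is verticially slim as soon as `G` is slim (memo (H2)). [cite: MochizukiSemiAnbd2006, Def 2.4 (ii) p.25] -/
theorem thetaRay_isVerticiallySlim (hG : Literature.AlgebraicGeometry.Frobenioids.IsSlimGroup G) :
    (thetaRay G E up low).IsVerticiallySlim := fun _ => hG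

end ThetaRay

/-! ### The memo's shape: twists `θ_m` and an exponent sequence `n_k` -/

section Twists

variable (G E : Type) [Group G] [TopologicalSpace G] [IsTopologicalGroup G] [CompactSpace G]
  [TotallyDisconnectedSpace G] [Group E] [TopologicalSpace E] [IsTopologicalGroup E] [CompactSpace E]
  [TotallyDisconnectedSpace E] (α : E →ₜ* G) (θ : ℕ → (G →ₜ* G)) (n : ℕ → ℕ)

/-- **`𝒢_θ` with twists** (memo §1 verbatim shape): `brHom β_k⁺ := α` and `brHom β_k⁻ := θ_{n_k} ∘ α` for a
family of continuous endomorphisms `θ_m` of `G` (brick R1: the automorphisms `a ↦ a·b^{p^m}, b ↦ b`) and an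
exponent sequence `n : ℕ → ℕ` (memo: strictly increasing, `n_0 ≥ 1`). [cite: MochizukiSemiAnbd2006, Def 2.1 p.22] -/
def thetaRayOfTwists : ProfiniteSemiGraph.{0} := thetaRay G E α (fun k => (θ (n k)).comp α)

/-- `thetaRayOfTwists` is `thetaRay` with `low k = θ_{n_k} ∘ α` (definitional).
[cite: MochizukiSemiAnbd2006, Def 2.1 p.22] -/
theorem thetaRayOfTwists_eq : thetaRayOfTwists G E α θ n = thetaRay G E α (fun k => (θ (n k)).comp α) := rfl

/-- The underlying semi-graph is the ray. [cite: MochizukiSemiAnbd2006, Def 2.1 p.22] -/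
@[simp] theorem thetaRayOfTwists_graph : (thetaRayOfTwists G E α θ n).graph = SemiGraph.ray := rfl

/-- The branch subgroup at `β_k⁺` is `A := range α`. [cite: MochizukiSemiAnbd2006, §2 p.23] -/
theorem thetaRayOfTwists_branchSubgroup_true (k v : ℕ) (h : SemiGraph.ray.abuts (k, true) = some v) :
    (thetaRayOfTwists G E α θ n).branchSubgroup (k, true) v h = α.toMonoidHom.range := rfl

/-- The branch subgroup at `β_k⁻` is `A_{n_k} := θ_{n_k}(A)`. [cite: MochizukiSemiAnbd2006, §2 p.23] -/
theorem thetaRayOfTwists_branchSubgroup_false (k v : ℕ) (h : SemiGraph.ray.abuts (k, false) = some v) :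
    (thetaRayOfTwists G E α θ n).branchSubgroup (k, false) v h =
      α.toMonoidHom.range.map (θ (n k)).toMonoidHom := by
  rw [← MonoidHom.range_comp]
  rfl

/-- `𝒢_θ` with twists is of injective type as soon as `α` and every `θ_{n_k} ∘ α` are injective (e.g. `α`
injective and the `θ_m` automorphisms). [cite: MochizukiSemiAnbd2006, Def 2.1 p.22] -/
theorem thetaRayOfTwists_isOfInjectiveType (hα : Function.Injective α)
    (hθ : ∀ k, Function.Injective (θ (n k))) : (thetaRayOfTwists G E α θ n).IsOfInjectiveType :=
  thetaRay_isOfInjectiveType G E α _ hα fun k => (hθ k).comp hα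

end Twists

end ProfiniteSemiGraph

end Literature.AnabelianGeometry.SemiGraphs
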